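import Summits.QuantumFields.YangMills.Theses.UnitScaleTilt
import Summits.QuantumFields.YangMills.Theorems.UnitScaleTiltHistoryTailIntSmallFactorRows
import Summits.QuantumFields.YangMills.Theorems.UnitScaleTiltHistoryTailAlphaConsumer
import HarnessLib

/-!
# `UnitScaleTiltHistoryTailLaneRowsIntRows` — THE F-2b `Rows` TWIN OF ✓`UnitScaleTiltHistoryTailLaneRowsInt` OVER THE ROWS RECORD `AlphaInputsT3AC.PkgCoreRows` (✓`AlphaInputsT3ACv4CoreRows`; ★★OWNER RULING g26-№14 (F-2b),
# bill v1.2 §7, ★alpha-2 g7 checklist (s1)–(s7)) — crux `HistoryTailL` (stmt-QuantumFields-19936), cell `ym3-torus`, width seat ym-ust-19936-w6 (g2)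

WHAT.  `UnitScaleTiltHistoryTailLaneRowsInt`'s statements and proofs VERBATIM with `PkgCoreV3 ↦ PkgCoreRows` (the rows record carries the version-4 run rows `runRows : AlphaV4AC.RunAlphaV4CoreAC` — the
currency-free (71) per recorded plaquette `h71` in place of the comb (67)-row —, so `(q K).runCore ↦ (q K).runRows`, `eq71_perPlaquette_of_alphaV3Core … ↦ (q K).smallFactor71 …`,
`abs_Pint_succ_le_of_alphaV3Core ↦ AlphaV4AC.abs_Pint_succ_le_of_alphaV4Core`); declaration names `dataIntV3(P)_<row> ↦ dataIntRows(P)_<row>`, `lfDataIntV3 ↦ lfDataIntRows`, `PkgCoreV3.<row> ↦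
PkgCoreRows.<row>`, and `+Rows` on the remaining theorem names.  HONEST FRAMING.  Bookkeeping twin (renaming + one field read); nothing of [Balaban1985UV3] is proved; CONDITIONAL on
the family of rows cores exactly as the original is on its cores; the v3 original stays in the tree unchanged; count-neutral helper toward 2′χ (`--supports stmt-QuantumFields-19936`);
registry untouched.  YM₃ on the three-torus is rung R3 of the programme, not the Clay problem; no mass gap is claimed.  THE ORIGINAL'S ACCOUNT (names read with the substitutions):
# Route `UnitScaleTilt` — crux K2-L `HistoryTailL` (stmt-QuantumFields-19936), R-57χ successor line: THE LANE'S CLAUSES AT THE INTERIOR DATUM OF A FAMILY OF DATA CORES,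
# IN THE SHAPES THE CONSUMER COMPOSITION READS (`HistoryTailLaneRows`, fleet lead `ym-ust-18916-p1` g5, VERBATIM with `(h : OfV3At …) ↦ (qf : ∀ K, PkgCoreRows …)`,
# `h.dataT3v3 hc γ hγ hγ1 π ↦ dataIntRows qf π`) — seat ym3-torus-p2 (g16); `--supports` 19936

* `smallFactorLane_intRows` — 2″ clause (b) (per-plaquette ∃-region small factor at `c := 1/8`, `R₀ := Run3SmallFactors.regionT`) from `dataIntRows_smallFactor71_lane`;
* `laneRows_intRows` — (b_c) ∧ (c) `PintSize` at `CP := C46·M₁³` (`dataIntRows_pintSize`) ∧ (d) the `Zterm` size at `κZ := Alf` (`dataIntRows_ztermSize`);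
* `windowedWeights_intRows` / `windowedWeights_int_v5p5ShapeRows` — 2‴ (print's windowed PINNED weights `PkgCoreRows.wtP`: (w0)(w1)(w2)(e′)(e″)(iv), `Bm = 1`).
All (41)-side; nothing of [Balaban1985UV3] is asserted; CONDITIONAL only on the family `qf`. [cite: Balaban1985UV3, (40)-(41) p.266, (46)-(47) p.267, (67)-(71) p.273]
-/

set_option autoImplicit false

noncomputable section

open MeasureTheory
open Literature.MathematicalPhysics.QuantumFieldTheory.Balaban1983to89
open Literature.MathematicalPhysics.QuantumFieldTheory.Balaban1983to89.T3ContinuumYM3Torus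
open Literature.MathematicalPhysics.QuantumFieldTheory.Balaban1983to89.T3UnitScaleTilt
open Literature.MathematicalPhysics.QuantumFieldTheory.Balaban1983to89.T3UnitLawDensityEML
open Literature.MathematicalPhysics.QuantumFieldTheory.Balaban1983to89.T3ThresholdSmallness (sqrt_coupling_pos_le)
open Literature.MathematicalPhysics.QuantumFieldTheory.Balaban1983to89.T3Thresholds (coupling_le_one)
open Literature.MathematicalPhysics.QuantumFieldTheory.Balaban1983to89.T3AlphaInputsAC
open Literature.MathematicalPhysics.QuantumFieldTheory.Balaban1983to89.T3AlphaInputsACSchemas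
open Literature.MathematicalPhysics.QuantumFieldTheory.Balaban1983to89.B10Eq38TorusDomains (toFine)
open Literature.MathematicalPhysics.QuantumFieldTheory.Balaban1983to89.T3RestrictedUnitDensity (resDensity integrable_resDensity)
open Literature.MathematicalPhysics.QuantumFieldTheory.Balaban1983to89.Missing (partitionFn measurable_plaqHol)
open Summit.QuantumFields.Balaban3D.Carriers (suGroupModel)
open Summit.QuantumFields.Balaban3D.Proofs.Primitives (AlphaConsts)
open Summit.QuantumFields.Balaban3D.Proofs.Run3SmallFactors (regionT src_mem_plaqCover_of_mem_regionT)
open Summit.QuantumFields.YangMills.Theorems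
open Summit.QuantumFields.YangMills.Theorems.HistoryTailDensityTransfer (gibbsK_real_preimage_iter_eq)
open Summit.QuantumFields.YangMills.Theorems.HistoryTailSandwich (partitionFn_eq_integral_resDensity)
open Summit.QuantumFields.YangMills.Theorems.HistoryTailMechanismA (integral_mul_indicator_one_eq_setIntegral)
open Summit.QuantumFields.YangMills.Theorems.HistoryTailAlphaConsumer (setIntegral_div_integral_le_ae)

namespace Summit.QuantumFields.YangMills.Theorems.HistoryTailLaneRowsInt

open Classical

/-- 2″ AT THE INTERIOR DATUM OF A FAMILY OF DATA CORES (`HistoryTailLaneRows.smallFactorLane_v3`'s text and proof over `qf`): **THE SMALL FACTORS (70)–(71) OF THE HISTORY'S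
LARGE-FIELD PLAQUETTES, IN THE LANE'S NORMALISATION** — a constant `c ∈ (0, ¼]` (`c := 1/8 = 1/(4N)`) and a threshold `γ₂` such that for every family of block size `L`, every family
of data cores `qf`, every `γ ≤ γ₂`, every admissible pair `(h, W)` (`Adm = ChargedT3`) of run `K` at level `j ≤ K` and every large-field plaquette `p′ ∈ P_i(h)` (`LargeP K j r i`)
there is a finite set `R₀` of fine plaquettes with base points in `Δ′(p′)` (`Carriers.plaqCover p′`; `R₀ := Run3SmallFactors.regionT (i, plaqCode p′)`) with
`c·p(g_i)² ≤ β_K·Σ_{q∈R₀}[1 − Re tr U_j(h,W)(∂q)]` (normalised trace) — from `AlphaInputsT3AC.dataIntRows_smallFactor71_lane`; p.273 «the part of the action (1/g_k²)A^η(U_k)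
localized to the sum of four j-blocks Δ′ … can be bounded from below by ¼p²(g_j)», `¼ = 1/(4N)` in the normalised trace of `SU(N)`. [cite: Balaban1985UV3, (67)-(71) p.273] -/
theorem smallFactorLane_intRows :
    ∀ (L : ℕ), Odd L → 1 < L →
      ∀ (𝔠 : AlphaConsts L (suGroupModel 2).N),
        ∃ (γ₂ c : ℝ), 0 < γ₂ ∧ 0 < c ∧ c ≤ 1 / 4 ∧
          ∀ (F : T3Family) (hF : F.L = L) (γ : ℝ) (hγ : 0 < γ) (hγ1 : γ ≤ (min (hF ▸ 𝔠).gamma0 1) ^ 2)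
            (qf : ∀ K, AlphaInputsT3AC.PkgCoreRows F (hF ▸ 𝔠) γ hγ hγ1 K) (π : AlphaInputsT3AC.PolymerT3 F), γ ≤ γ₂ →
            ∀ (K j : ℕ) (r : (AlphaInputsT3AC.lfDataIntRows qf π).Reg K j) (v : (i : Fin j) → GaugeField (F.P K) i (Matrix.specialUnitaryGroup (Fin 2) ℂ))
              (Wf : GaugeField (F.P K) j (Matrix.specialUnitaryGroup (Fin 2) ℂ)), j ≤ K →
              (AlphaInputsT3AC.dataIntRows qf π).Adm K j ((AlphaInputsT3AC.lfDataIntRows qf π).assemble K j r v) Wf →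
              ∀ (i : ℕ) (p' : Plaq (F.P K) i), p' ∈ (AlphaInputsT3AC.lfDataIntRows qf π).LargeP K j r i →
                ∃ R₀ : Finset (Plaq (F.P K) 0), (∀ q ∈ R₀, q.src ∈ Summit.QuantumFields.Balaban3D.Carriers.plaqCover p') ∧
                  c * B10.pFun (hF ▸ 𝔠).b₀ (hF ▸ 𝔠).p₀ (Real.sqrt (γ * ((F.L : ℝ)⁻¹) ^ (K - i))) ^ 2 ≤
                    (F.scheme ℰp γ).β K *
                      ∑ q ∈ R₀, (1 - reTr (GaugeField.plaqHol
                        ((AlphaInputsT3AC.dataIntRows qf π).Umin K j ((AlphaInputsT3AC.lfDataIntRows qf π).assemble K j r v) Wf) q)) := by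
  intro L hLo hL 𝔠
  refine ⟨1, 1 / 8, one_pos, by norm_num, by norm_num, fun F hF => ?_⟩
  subst hF
  intro γ hγ hγ1 qf π _ K j r v Wf hjK hadm i p' hp'
  have hij := (AlphaInputsT3AC.lfDataIntRows_largeP_geom qf π K j hjK r v i p' hp').1
  exact ⟨regionT (S := T3Scales F γ hγ (hγ1.trans (sq_min_one_le _ 𝔠.gamma0_pos)) K)
      ((i, Summit.QuantumFields.Balaban3D.Carriers.plaqCode p') : ℕ × Summit.QuantumFields.Balaban3D.Carriers.PlaqCode (F.P K)),
    fun q hq => (src_mem_plaqCover_of_mem_regionT (S := T3Scales F γ hγ (hγ1.trans (sq_min_one_le _ 𝔠.gamma0_pos)) K)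
      (show i ≤ F.m + K by omega) p' hq).1,
    AlphaInputsT3AC.dataIntRows_smallFactor71_lane qf π K j r v Wf hjK hadm i p' hp'⟩

/-- THE LANE CLAUSES AT THE INTERIOR DATUM IN THE SHAPE THE COMPOSITION CONSUMES: (b_c) from `smallFactorLane_intRows`, (c) `PintSize` at `CP := C46·M₁³` (`dataIntRows_pintSize`) and (d) the
`Zterm` size at `κZ := Alf` (`dataIntRows_ztermSize`). [cite: Balaban1985UV3, (41) p.266, (46) p.267 and (67)-(71) p.273] -/
theorem laneRows_intRows :
    ∀ (L : ℕ), Odd L → 1 < L →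
      ∀ (𝔠 : AlphaConsts L (suGroupModel 2).N),
        ∃ (γ₂ c CP κZ : ℝ), 0 < γ₂ ∧ 0 < c ∧ c ≤ 1 / 4 ∧ 0 ≤ CP ∧ 0 ≤ κZ ∧
          ∀ (F : T3Family) (hF : F.L = L) (γ : ℝ) (hγ : 0 < γ) (hγ1 : γ ≤ (min (hF ▸ 𝔠).gamma0 1) ^ 2)
            (qf : ∀ K, AlphaInputsT3AC.PkgCoreRows F (hF ▸ 𝔠) γ hγ hγ1 K) (π : AlphaInputsT3AC.PolymerT3 F), γ ≤ γ₂ →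
            (∀ (K j : ℕ) (r : (AlphaInputsT3AC.lfDataIntRows qf π).Reg K j) (v : (i : Fin j) → GaugeField (F.P K) i (Matrix.specialUnitaryGroup (Fin 2) ℂ))
              (Wf : GaugeField (F.P K) j (Matrix.specialUnitaryGroup (Fin 2) ℂ)), j ≤ K →
              (AlphaInputsT3AC.dataIntRows qf π).Adm K j ((AlphaInputsT3AC.lfDataIntRows qf π).assemble K j r v) Wf →
              ∀ (i : ℕ) (p' : Plaq (F.P K) i), p' ∈ (AlphaInputsT3AC.lfDataIntRows qf π).LargeP K j r i →
                ∃ R₀ : Finset (Plaq (F.P K) 0), (∀ q ∈ R₀, q.src ∈ Summit.QuantumFields.Balaban3D.Carriers.plaqCover p') ∧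
                  c * B10.pFun (hF ▸ 𝔠).b₀ (hF ▸ 𝔠).p₀ (Real.sqrt (γ * ((F.L : ℝ)⁻¹) ^ (K - i))) ^ 2 ≤
                    (F.scheme ℰp γ).β K *
                      ∑ q ∈ R₀, (1 - reTr (GaugeField.plaqHol
                        ((AlphaInputsT3AC.dataIntRows qf π).Umin K j ((AlphaInputsT3AC.lfDataIntRows qf π).assemble K j r v) Wf) q))) ∧
            PintSize (AlphaInputsT3AC.dataIntRows qf π) (hF ▸ 𝔠).b₀ (hF ▸ 𝔠).p₀ CP ∧
            (∀ (K j : ℕ) (r : (AlphaInputsT3AC.lfDataIntRows qf π).Reg K j) (v : (i : Fin j) → GaugeField (F.P K) i (Matrix.specialUnitaryGroup (Fin 2) ℂ)),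
              j ≤ K →
                0 ≤ (AlphaInputsT3AC.dataIntRows qf π).Zterm K j ((AlphaInputsT3AC.lfDataIntRows qf π).assemble K j r v) ∧
                (AlphaInputsT3AC.dataIntRows qf π).Zterm K j ((AlphaInputsT3AC.lfDataIntRows qf π).assemble K j r v) ≤
                  κZ * ∑ i ∈ Finset.range j,
                    (1 + Real.log (Real.sqrt (γ * ((F.L : ℝ)⁻¹) ^ (K - i)))⁻¹) *
                      (({y : Site (F.P K) i | toFine i y ∉ (AlphaInputsT3AC.dataIntRows qf π).Ω K j
                          ((AlphaInputsT3AC.lfDataIntRows qf π).assemble K j r v) (i + 1)} : Set (Site (F.P K) i)).ncard : ℝ)) := by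
  intro L hLo hL 𝔠
  obtain ⟨γ₂, c, hγ₂, hc0, hc4, hrows⟩ := smallFactorLane_intRows L hLo hL 𝔠
  refine ⟨γ₂, c, 𝔠.C46 * (𝔠.M₁ : ℝ) ^ 3, 𝔠.Alf, hγ₂, hc0, hc4, by have := 𝔠.C46_nonneg; positivity, 𝔠.Alf_nonneg, fun F hF => ?_⟩
  subst hF
  intro γ hγ hγ1 qf π hγ₂
  exact ⟨hrows F rfl γ hγ hγ1 qf π hγ₂, AlphaInputsT3AC.dataIntRows_pintSize qf π, fun K j r v hj => AlphaInputsT3AC.dataIntRows_ztermSize qf π K j r v hj⟩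

/-- 2‴ AT THE INTERIOR DATUM OF A FAMILY OF DATA CORES (`HistoryTailLaneRows.windowedWeights_v3`'s text and proof over `qf`, `wt′ := PkgCoreRows.wtP`, print's windowed PINNED
weights) — **THE WINDOWED WEIGHTS** of ALL region histories of the datum (whose regions, minimiser, `mainT`, `Pint`, `Zterm`, `χ`, `low`, `Rm`, `LargeP` it keeps): (w0) `wt′ ≥ 0`;
(w1) `wt′ = 0` on inadmissible histories; (w2) at levels `1 ≤ j ≤ K` a non-zero weight charges an admissible pair, for EVERY field (print (40) p.266 «χ_j, j = 1, …, k»; no window at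
level 0); (e′) integrable with `∫ wt′ ≤ 1` (K-uniform); (e″) the interaction `Pint_j(r, ·)` measurable; (iv) the upper inductive inequality (41′) a.e. + integrability for the majorant
assembled from `wt′` — the datum `dataIntRows` with `LF` replaced (structure update inline; = `dataIntRowsP`). [cite: Balaban1985UV3, (40)-(41) p.266, (47) p.267 and (55) p.269] -/
theorem windowedWeights_intRows :
    ∀ (L : ℕ), Odd L → 1 < L →
      ∀ (𝔠 : AlphaConsts L (suGroupModel 2).N),
          ∀ (F : T3Family) (hF : F.L = L) (γ : ℝ) (hγ : 0 < γ) (hγ1 : γ ≤ (min (hF ▸ 𝔠).gamma0 1) ^ 2)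
            (qf : ∀ K, AlphaInputsT3AC.PkgCoreRows F (hF ▸ 𝔠) γ hγ hγ1 K) (π : AlphaInputsT3AC.PolymerT3 F),
            ∃ wt' : (K j : ℕ) → Summit.QuantumFields.Balaban3D.Carriers.Hist (F.P K) j → GaugeField (F.P K) j (Matrix.specialUnitaryGroup (Fin 2) ℂ) → ℝ,
              (∀ K j r Wf, 0 ≤ wt' K j r Wf) ∧
              (∀ (K j : ℕ) (r : Summit.QuantumFields.Balaban3D.Carriers.Hist (F.P K) j) Wf,
                ¬ Summit.QuantumFields.Balaban3D.Carriers.Hist.Admissible (hF ▸ 𝔠).lane.carrier.M₁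
                  (Summit.QuantumFields.Balaban3D.Carriers.rcolOf (T3Scales F γ hγ (hγ1.trans (sq_min_one_le _ (hF ▸ 𝔠).gamma0_pos)) K)
                    (hF ▸ 𝔠).lane.carrier) j r →
                wt' K j r Wf = 0) ∧
              (∀ (K j : ℕ) (r : Summit.QuantumFields.Balaban3D.Carriers.Hist (F.P K) j), 1 ≤ j → j ≤ K →
                ∀ Wf : GaugeField (F.P K) j (Matrix.specialUnitaryGroup (Fin 2) ℂ),
                  wt' K j r Wf ≠ 0 → (AlphaInputsT3AC.dataIntRows qf π).Adm K j r Wf) ∧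
              (∀ (K j : ℕ) (r : Summit.QuantumFields.Balaban3D.Carriers.Hist (F.P K) j),
                Integrable (wt' K j r) (fieldMeasure (F.P K) j (Matrix.specialUnitaryGroup (Fin 2) ℂ)) ∧
                ∫ Wf, wt' K j r Wf ∂fieldMeasure (F.P K) j (Matrix.specialUnitaryGroup (Fin 2) ℂ) ≤ 1) ∧
              (∀ (K j : ℕ) (r : Summit.QuantumFields.Balaban3D.Carriers.Hist (F.P K) j), j ≤ K →
                Measurable fun Wf : GaugeField (F.P K) j (Matrix.specialUnitaryGroup (Fin 2) ℂ) => (AlphaInputsT3AC.dataIntRows qf π).Pint K j r Wf) ∧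
              (∀ (K j : ℕ), j ≤ K →
                Ineq41AE ({ AlphaInputsT3AC.dataIntRows qf π with
                    LF := fun K j Wf Φ => wt' K j (Summit.QuantumFields.Balaban3D.Carriers.Hist.triv (F.P K) j) Wf *
                        Real.exp (Φ (Summit.QuantumFields.Balaban3D.Carriers.Hist.triv (F.P K) j)) +
                      ∑ r ∈ Finset.univ.erase (Summit.QuantumFields.Balaban3D.Carriers.Hist.triv (F.P K) j),
                        wt' K j r Wf * Real.exp (Φ r) } : AlphaDataT3 F γ) K j ∧
                Integrable (AlphaDataT3.up ({ AlphaInputsT3AC.dataIntRows qf π with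
                    LF := fun K j Wf Φ => wt' K j (Summit.QuantumFields.Balaban3D.Carriers.Hist.triv (F.P K) j) Wf *
                        Real.exp (Φ (Summit.QuantumFields.Balaban3D.Carriers.Hist.triv (F.P K) j)) +
                      ∑ r ∈ Finset.univ.erase (Summit.QuantumFields.Balaban3D.Carriers.Hist.triv (F.P K) j),
                        wt' K j r Wf * Real.exp (Φ r) } : AlphaDataT3 F γ) K j)
                  (fieldMeasure (F.P K) j (Matrix.specialUnitaryGroup (Fin 2) ℂ))) := by
  intro L _ _ 𝔠 F hF
  subst hF
  intro γ hγ hγ1 qf π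
  exact ⟨fun K j r => (qf K).wtP j r,
    fun K j r Wf => AlphaInputsT3AC.PkgCoreRows.wtP_nonneg (qf K) j r Wf,
    fun K j r Wf hr => AlphaInputsT3AC.PkgCoreRows.wtP_eq_zero_of_not_admissible (qf K) j r Wf hr,
    fun K j r hj1 hj Wf hW => AlphaInputsT3AC.dataIntRows_adm_of_wtP_ne_zero qf π K j hj1 hj r Wf hW,
    fun K j r => AlphaInputsT3AC.PkgCoreRows.integrable_wtP_and_integral_le (qf K) j r,
    fun K j r hj => AlphaInputsT3AC.dataIntRows_measurable_Pint qf π K j hj r,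
    fun K j hj => ⟨AlphaInputsT3AC.dataIntRowsP_ineq41AE qf π K j hj, AlphaInputsT3AC.dataIntRowsP_integrable_up qf π K j hj⟩⟩

/-- ADAPTER: 2‴ in the bundle shape (threshold-free, `Bm = 1`, (w2) POINTWISE for `1 ≤ j ≤ K`) implies v5p5's shape (`γw := 1`, `Bm := 1`, (w2) a.e.), which the composition
`…LaneTailInt.perPlaquetteHigh_intRows` consumes unchanged. [folklore] -/
theorem windowedWeights_int_v5p5ShapeRows :
    ∀ (L : ℕ), Odd L → 1 < L →
      ∀ (𝔠 : AlphaConsts L (suGroupModel 2).N),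
        ∃ (γw Bm : ℝ), 0 < γw ∧ 0 ≤ Bm ∧
          ∀ (F : T3Family) (hF : F.L = L) (γ : ℝ) (hγ : 0 < γ) (hγ1 : γ ≤ (min (hF ▸ 𝔠).gamma0 1) ^ 2)
            (qf : ∀ K, AlphaInputsT3AC.PkgCoreRows F (hF ▸ 𝔠) γ hγ hγ1 K) (π : AlphaInputsT3AC.PolymerT3 F), γ ≤ γw →
            ∃ wt' : (K j : ℕ) → Summit.QuantumFields.Balaban3D.Carriers.Hist (F.P K) j → GaugeField (F.P K) j (Matrix.specialUnitaryGroup (Fin 2) ℂ) → ℝ,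
              (∀ K j r Wf, 0 ≤ wt' K j r Wf) ∧
              (∀ (K j : ℕ) (r : Summit.QuantumFields.Balaban3D.Carriers.Hist (F.P K) j) Wf,
                ¬ Summit.QuantumFields.Balaban3D.Carriers.Hist.Admissible (hF ▸ 𝔠).lane.carrier.M₁
                  (Summit.QuantumFields.Balaban3D.Carriers.rcolOf (T3Scales F γ hγ (hγ1.trans (sq_min_one_le _ (hF ▸ 𝔠).gamma0_pos)) K)
                    (hF ▸ 𝔠).lane.carrier) j r →
                wt' K j r Wf = 0) ∧
              (∀ (K j : ℕ) (r : Summit.QuantumFields.Balaban3D.Carriers.Hist (F.P K) j), j ≤ K → 1 ≤ j →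
                ∀ᵐ Wf ∂fieldMeasure (F.P K) j (Matrix.specialUnitaryGroup (Fin 2) ℂ),
                  wt' K j r Wf ≠ 0 → (AlphaInputsT3AC.dataIntRows qf π).Adm K j r Wf) ∧
              (∀ (K j : ℕ) (r : Summit.QuantumFields.Balaban3D.Carriers.Hist (F.P K) j), j ≤ K →
                Integrable (wt' K j r) (fieldMeasure (F.P K) j (Matrix.specialUnitaryGroup (Fin 2) ℂ)) ∧
                ∫ Wf, wt' K j r Wf ∂fieldMeasure (F.P K) j (Matrix.specialUnitaryGroup (Fin 2) ℂ) ≤ Bm) ∧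
              (∀ (K j : ℕ) (r : Summit.QuantumFields.Balaban3D.Carriers.Hist (F.P K) j), j ≤ K →
                Measurable fun Wf : GaugeField (F.P K) j (Matrix.specialUnitaryGroup (Fin 2) ℂ) => (AlphaInputsT3AC.dataIntRows qf π).Pint K j r Wf) ∧
              (∀ (K j : ℕ), j ≤ K →
                Ineq41AE ({ AlphaInputsT3AC.dataIntRows qf π with
                    LF := fun K j Wf Φ => wt' K j (Summit.QuantumFields.Balaban3D.Carriers.Hist.triv (F.P K) j) Wf *
                        Real.exp (Φ (Summit.QuantumFields.Balaban3D.Carriers.Hist.triv (F.P K) j)) +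
                      ∑ r ∈ Finset.univ.erase (Summit.QuantumFields.Balaban3D.Carriers.Hist.triv (F.P K) j),
                        wt' K j r Wf * Real.exp (Φ r) } : AlphaDataT3 F γ) K j ∧
                Integrable (AlphaDataT3.up ({ AlphaInputsT3AC.dataIntRows qf π with
                    LF := fun K j Wf Φ => wt' K j (Summit.QuantumFields.Balaban3D.Carriers.Hist.triv (F.P K) j) Wf *
                        Real.exp (Φ (Summit.QuantumFields.Balaban3D.Carriers.Hist.triv (F.P K) j)) +
                      ∑ r ∈ Finset.univ.erase (Summit.QuantumFields.Balaban3D.Carriers.Hist.triv (F.P K) j),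
                        wt' K j r Wf * Real.exp (Φ r) } : AlphaDataT3 F γ) K j)
                  (fieldMeasure (F.P K) j (Matrix.specialUnitaryGroup (Fin 2) ℂ))) := by
  intro L hLo hL 𝔠
  refine ⟨1, 1, one_pos, zero_le_one, fun F hF γ hγ hγ1 qf π _ => ?_⟩
  obtain ⟨wt', h0, h1, h2, h3, h4, h5⟩ := windowedWeights_intRows L hLo hL 𝔠 F hF γ hγ hγ1 qf π
  exact ⟨wt', h0, h1, fun K j r hjK hj1 => ae_of_all _ (h2 K j r hj1 hjK), fun K j r _ => h3 K j r, h4, h5⟩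

end Summit.QuantumFields.YangMills.Theorems.HistoryTailLaneRowsInt
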